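import Literature.MathematicalPhysics.QuantumFieldTheory.Balaban1983to89.BlockAveragingEMLProp2
import Literature.MathematicalPhysics.QuantumFieldTheory.Balaban1983to89.T3UnitLawDensityEML
import Literature.MathematicalPhysics.QuantumFieldTheory.Balaban1983to89.T3ContinuumYM3Torus
import Literature.MathematicalPhysics.QuantumFieldTheory.Balaban1983to89.T3TiltDescent
import HarnessLib

/-!
# S2β · (C-word) «A LEVEL-`i` AVERAGE OF A FINE-SMALL, FINE-FLAT FIELD IS `≤ (σ₀·η⁻¹ + C·ε)·Lⁱη`»: the sup (bond-size) profile of the (0.4)-averaged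
# tower `Ū^i U₀` from ONE fine bond letter `dist1 (U₀ ℓ) ≤ σ₀` and the plaquette profile of the tower — straight word of `L` bonds + correction factor

Cell `ym3-torus` (YM ladder rung R3 = continuum `SU(2)` Yang–Mills on the three-torus at fixed lattice data — a RUNG: NOT d = 4, NOT infinite volume, NOT
a mass gap, NOT Clay).  Width seat «width 20» `ym3-torus-px20` (gen 25), FREE px helper on crux `stmt-QuantumFields-20520`, LINE g18-1 S2β.  ROW (C-word)
named by the architect (px17 g23 2026-09-01T02:05:16Z (2): «row (REG-UP) C-σ of record := (RES-u.7σ) ∘ (C-word) “a level-i average of a fine-small, fine-flat field is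
`≤ (σ_fine·η⁻¹ + d²ε₀)·Lⁱη`” — GLOBAL»; desk WORD №713 «(C-word) OFFERED by px20 g25; silence = px20's»).  CONSUMERS: (REG-UP) C-σ (px13 g29) and w5 g29's
✓`bondGrad_descTransf_le_of_descent` (the displayed `hdesc : ∀ B, dist1 (descendTo … (g•U₀) B) ≤ s′`).  `--kind proof --supports stmt-QuantumFields-20520 --as helper`,
count-neutral, DEFINITION-FREE (0 `def`, 0 `instance`, 0 `notation`, 0 `sorry`, default heartbeats).

WHAT IS PROVED (sorry-free; every plaquette hypothesis NON-STRICT `≤`, so the station's (BKG) binder docks verbatim).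
§1 (generic `P : Params`, any `GaugeGroup` ∕ `SU(N)` with the PRINTED `exp[mean log]`): `dist1_pathProd_le` (`dist1 (U(b₀⋯b_{k−1})) ≤ k·σ`);
   ★`dist1_avgFun_le_of_bond_le (hσ : ∀ b, dist1 (U b) ≤ σ) (ha : 0 ≤ a) (hU : ∀ q, dist1 (U(∂q)) ≤ a) (hδ : θ < δ_N) (h6 : θ ≤ 1∕6) (c) :
   dist1 (avgFun expMeanLogSU U c) ≤ L·σ + 2θ`, `θ := ((d+2)L)²∕4·a` — `Ū(c) = corr·U(Γ_c)`: the straight word (§1) + the correction factor by lit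
   ✓`BlockAveragingEMLProp2.dist1_corr_le_two_mul` ∘ ✓`dist1_loopHol_le'` (loops ⟸ plaquettes by lattice Stokes, [Balaban1985Averaging] (19)–(20)).
§2 ★★`dist1_iter_le_of_bond_le (hσ₀ : ∀ ℓ, dist1 (U ℓ) ≤ σ₀) (N) (a) (ha) (hplaq : ∀ k < N, ∀ q, dist1 ((Ū^k U)(∂q)) ≤ a k) (hδ) (h6) :
   ∀ i ≤ N, ∀ b, dist1 (Ū^i U b) ≤ L^i·σ₀ + Σ_{k<i} L^{i−1−k}·(2·((d+2)L)²∕4·a k)` (§1 iterated; `rec_step` is the bookkeeping).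
§3 (`T3Family`, `ℰp`, `SU(2)`): `geom_mixed_sum` (`Σ_{k<i} L^{i−1−k}·L^{2k} = (L^{2i} − L^i)∕(L² − L)`, the exact solution of the recursion); ★★★`dist1_iter_le_bkg (hσ₀) (hCB hα)
   (hBKG : ⟨the station's (BKG) binder VERBATIM: ∀ t ≤ K−J, ∀ p, dist1 ((Ū^t U₀)(∂p)) ≤ C_B·α·L^{2t}·(L⁻¹)^{2(K−J)}⟩) (hδ : ((3+2)L)²∕4·(C_Bα) < δ₂) (h6 : … ≤ 1∕6) :
   ∀ i ≤ K−J, ∀ b, dist1 (Ū^i U₀ b) ≤ L^i·σ₀ + (2·((3+2)L)²∕4)·(C_B·α·(L⁻¹)^{2(K−J)})·(L^{2i} − L^i)∕(L² − L)`; ★★`dist1_iter_le_bkg'` — the `η`-form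
   **`dist1 (Ū^i U₀ b) ≤ L^i·σ₀ + ((3+2)²L∕(2(L−1)))·(C_B·α)·(L^i·(L⁻¹)^{K−J})²`** (with `σ₀ = η·s₀`: `≤ (s₀ + C·C_B·α)·L^iη`, the architect's shape, `C = 25L∕(2(L−1))`);
   ★★`dist1_descendTo_le_bkg (hJK) … (B : PBond (F.P J) 0) : dist1 (descendTo F ℰp J K hJK U₀ B) ≤ L^{K−J}·σ₀ + ((3+2)²L∕(2(L−1)))·(C_B·α)` — the `s′` of (RES-u.7σ) §6.
WINDOW NOTE.  `hδ`∕`h6` ask `((d+2)L)²∕4·(C_B·α) ≤ 1∕6` and `< δ₂` (genre of ✓p839707's displayed `(((d+2)L)²∕4)·C_B·α ≤ min(1∕24, δ_SU∕2)`); `L^{2t}·(L⁻¹)^{2(K−J)} ≤ 1`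
for `t ≤ K − J` carries them to every level.

HONEST SCOPE.  Triangle inequalities for `dist1` along the averaging word and a geometric sum; the (0.4) correction-factor bound is the tree's (lit, by name); nothing of
Bałaban's renormalisation-group analysis is asserted or proved ([Balaban1987RG1] (0.4), (0.11) p.253; [Balaban1985Averaging] (19)–(20) p.21); the fine bond letter `σ₀`
(`hBG` read at height `K`, desk №712∕RULING №131), the (BKG) class and the windows are HYPOTHESES; (REG-UP) C, (RES-u.7)∕(7σ), GAP♯∘ (`stub_uniformFibreGapOrbit`, registry
3732b7df UNTOUCHED, 0∕5), the five registered stubs, S2β, crux 20520, 19936, 19200 and `YM3TorusSU2` are NOT proved; no registered stub is closed; rung R3 — NOT d = 4,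
NOT infinite volume, NOT a mass gap, NOT Clay; the Yang–Mills mass gap is NOT proved.
-/

set_option autoImplicit false
noncomputable section
open scoped Matrix.Norms.L2Operator
open Finset
namespace Summit.QuantumFields.YangMills.Theorems.FluctuationComparisonRegPrIntLS2BetaAveragedBondWord

open Literature.MathematicalPhysics.QuantumFieldTheory.Balaban1983to89
open Literature.MathematicalPhysics.QuantumFieldTheory.Balaban1983to89.T4Continuum
open Literature.MathematicalPhysics.QuantumFieldTheory.Balaban1983to89.BlockAveraging (Idx avgFun corr loopHol blockAvg blockAvg_avg)
open Literature.MathematicalPhysics.QuantumFieldTheory.Balaban1983to89.AveragingRT (pathProd axialAvg line)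
open Literature.MathematicalPhysics.QuantumFieldTheory.Balaban1983to89.ExpMeanLog (expMeanLogSU deltaSU)
open Literature.MathematicalPhysics.QuantumFieldTheory.Balaban1983to89.BlockAveragingEMLProp2 (dist1_loopHol_le' dist1_corr_le_two_mul)
open Literature.MathematicalPhysics.QuantumFieldTheory.Balaban1983to89.T3ContinuumYM3Torus
open Literature.MathematicalPhysics.QuantumFieldTheory.Balaban1983to89.T3UnitLawDensityEML (ℰp)
open Literature.MathematicalPhysics.QuantumFieldTheory.Balaban1983to89.T3TiltDescent (descendTo)
open Literature.MathematicalPhysics.QuantumFieldTheory.Balaban1983to89.T3LevelShift (bondShift)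

/-! ## §1 One step (generic lattice `P`, `SU(N)`, printed averaging `exp[mean log]`) -/
section OneStep

variable {n : Type*} [Fintype n] [DecidableEq n] [Nonempty n] {P : Params} {j : ℕ}

/-- The straight transporter of `k` bonds is within `k·σ` of `1` when every bond is within `σ`. [cite: Balaban1984PropagatorsI, (1.7) p.18] -/
theorem dist1_pathProd_le {G : Type*} [GaugeGroup G] (U : GaugeField P j G) (c : PBond P (j + 1)) {σ : ℝ}
    (hσ : ∀ b, dist1 (U b) ≤ σ) : ∀ k : ℕ, dist1 (pathProd U c k) ≤ k * σ
  | 0 => by simp [pathProd, GaugeGroup.dist1_one]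
  | k + 1 => by
    rw [pathProd, Nat.cast_succ, add_mul, one_mul]
    exact (GaugeGroup.dist1_mul_le _ _).trans (add_le_add (dist1_pathProd_le U c hσ k) (hσ _))

/-- ★ **ONE AVERAGING STEP**: if every bond of the `SU(N)` field `U` is within `σ` of `1` and every plaquette within `a` (`a ≥ 0`, with the printed smallness
`θ := ((d+2)L)²a∕4 < δ_N`, `θ ≤ 1∕6` of the (0.4) loop variables), then every bond of `Ū = avgFun exp[mean log] U` is within `L·σ + 2θ` of `1` — the straight
word of `L` bonds (§1) times the correction factor (lit ✓`dist1_corr_le_two_mul` ∘ ✓`dist1_loopHol_le'`). [cite: Balaban1987RG1, (0.4) p.253; Balaban1985Averaging, (19)-(20) p.21] -/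
theorem dist1_avgFun_le_of_bond_le (U : GaugeField P j (Matrix.specialUnitaryGroup n ℂ)) {σ a : ℝ}
    (hσ : ∀ b, dist1 (U b) ≤ σ) (ha : 0 ≤ a) (hU : ∀ q : Plaq P j, dist1 (GaugeField.plaqHol U q) ≤ a)
    (hδ : ((((P.d + 2) * P.L : ℕ) : ℝ) ^ 2 / 4) * a < deltaSU n) (h6 : ((((P.d + 2) * P.L : ℕ) : ℝ) ^ 2 / 4) * a ≤ 1 / 6)
    (c : PBond P (j + 1)) :
    dist1 (avgFun (expMeanLogSU (n := n)) U c) ≤ (P.L : ℝ) * σ + 2 * (((((P.d + 2) * P.L : ℕ) : ℝ) ^ 2 / 4) * a) := by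
  have hcorr := dist1_corr_le_two_mul U c (fun i => dist1_loopHol_le' ha hU c i) hδ h6
  have hax : dist1 (axialAvg U c) ≤ (P.L : ℝ) * σ := dist1_pathProd_le U c hσ P.L
  calc dist1 (avgFun (expMeanLogSU (n := n)) U c) = dist1 (corr (expMeanLogSU (n := n)) U c * axialAvg U c) := rfl
    _ ≤ dist1 (corr (expMeanLogSU (n := n)) U c) + dist1 (axialAvg U c) := GaugeGroup.dist1_mul_le _ _
    _ ≤ _ := by linarith

end OneStep

/-! ## §2 The tower (generic lattice `P`, `SU(N)`) -/
section Tower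

variable {n : Type*} [Fintype n] [DecidableEq n] [Nonempty n] {P : Params}

/-- The bookkeeping of one recursion step `x_{i+1} = L·x_i + c_i` in closed form. [folklore] -/
theorem rec_step (L σ₀ : ℝ) (c : ℕ → ℝ) (i : ℕ) :
    L * (L ^ i * σ₀ + ∑ k ∈ Finset.range i, L ^ (i - 1 - k) * c k) + c i =
      L ^ (i + 1) * σ₀ + ∑ k ∈ Finset.range (i + 1), L ^ (i + 1 - 1 - k) * c k := by
  rw [Finset.sum_range_succ]
  have hrw : ∑ k ∈ Finset.range i, L ^ (i + 1 - 1 - k) * c k = L * ∑ k ∈ Finset.range i, L ^ (i - 1 - k) * c k := by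
    rw [Finset.mul_sum]
    refine Finset.sum_congr rfl fun k hk => ?_
    have hk' := Finset.mem_range.mp hk
    rw [← mul_assoc, ← pow_succ']
    congr 2
    omega
  have h0 : L ^ (i + 1 - 1 - i) = 1 := by rw [show i + 1 - 1 - i = 0 by omega, pow_zero]
  rw [hrw, h0, one_mul, pow_succ']
  ring

/-- ★★ **THE SUP PROFILE OF THE AVERAGED TOWER**: from `dist1 (U ℓ) ≤ σ₀` on the finest lattice and the plaquette profile `a k` of the tower (`∀ k < N`, plaquettes of
`Ū^k U` within `a k ≥ 0`, loop smallness `((d+2)L)²a_k∕4 < δ_N`, `≤ 1∕6`): for every `i ≤ N` and every level-`i` bond,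
`dist1 (Ū^i U b) ≤ L^i·σ₀ + Σ_{k<i} L^{i−1−k}·(2·((d+2)L)²∕4·a k)` — §1 iterated. [cite: Balaban1987RG1, (0.4), (0.11) p.253; Balaban1985Averaging, (19)-(20) p.21] -/
theorem dist1_iter_le_of_bond_le (U : GaugeField P 0 (Matrix.specialUnitaryGroup n ℂ)) {σ₀ : ℝ} (hσ₀ : ∀ ℓ, dist1 (U ℓ) ≤ σ₀)
    (N : ℕ) (a : ℕ → ℝ) (ha : ∀ k, k < N → 0 ≤ a k)
    (hplaq : ∀ k, k < N → ∀ q : Plaq P k,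
      dist1 (GaugeField.plaqHol (Averaging.iter (fun k => blockAvg (P := P) (j := k) (expMeanLogSU (n := n))) k U) q) ≤ a k)
    (hδ : ∀ k, k < N → ((((P.d + 2) * P.L : ℕ) : ℝ) ^ 2 / 4) * a k < deltaSU n)
    (h6 : ∀ k, k < N → ((((P.d + 2) * P.L : ℕ) : ℝ) ^ 2 / 4) * a k ≤ 1 / 6) :
    ∀ i, i ≤ N → ∀ b : PBond P i,
      dist1 (Averaging.iter (fun k => blockAvg (P := P) (j := k) (expMeanLogSU (n := n))) i U b) ≤
        (P.L : ℝ) ^ i * σ₀ + ∑ k ∈ Finset.range i, (P.L : ℝ) ^ (i - 1 - k) * (2 * (((((P.d + 2) * P.L : ℕ) : ℝ) ^ 2 / 4) * a k))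
  | 0, _, b => by simpa [Averaging.iter] using hσ₀ b
  | i + 1, hi, b => by
    have ih := dist1_iter_le_of_bond_le U hσ₀ N a ha hplaq hδ h6 i (by omega)
    have hstep := dist1_avgFun_le_of_bond_le (n := n)
      (Averaging.iter (fun k => blockAvg (P := P) (j := k) (expMeanLogSU (n := n))) i U)
      ih (ha i (by omega)) (hplaq i (by omega)) (hδ i (by omega)) (h6 i (by omega)) b
    exact (le_of_eq rfl).trans (hstep.trans (le_of_eq
      (rec_step (P.L : ℝ) σ₀ (fun k => 2 * (((((P.d + 2) * P.L : ℕ) : ℝ) ^ 2 / 4) * a k)) i)))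

end Tower

/-! ## §3 The (BKG)-class edition on the cell's `T³` families (`ℰp`, `SU(2)`): `dist1 (Ū^i U₀ b) ≤ L^i·σ₀ + C·(C_B·α)·(L^i·η)²`, `η = L^{−(K−J)}` -/
section Bkg

variable (F : T3Family)

/-- The closed form of the recursion `x_{i+1} = L·x_i + c·A·L^{2i}`: `Σ_{k<i} L^{i−1−k}·L^{2k} = (L^{2i} − L^i)∕(L² − L)` (`L > 1`). [folklore] -/
theorem geom_mixed_sum (L : ℝ) (hL : 1 < L) :
    ∀ i : ℕ, ∑ k ∈ Finset.range i, L ^ (i - 1 - k) * L ^ (2 * k) = (L ^ (2 * i) - L ^ i) / (L ^ 2 - L)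
  | 0 => by simp
  | i + 1 => by
    have hLL : L ^ 2 - L ≠ 0 := by nlinarith
    rw [Finset.sum_range_succ]
    have hrw : ∑ k ∈ Finset.range i, L ^ (i + 1 - 1 - k) * L ^ (2 * k) = L * ∑ k ∈ Finset.range i, L ^ (i - 1 - k) * L ^ (2 * k) := by
      rw [Finset.mul_sum]
      refine Finset.sum_congr rfl fun k hk => ?_
      have hk' := Finset.mem_range.mp hk
      rw [← mul_assoc, ← pow_succ']
      congr 2
      omega
    have h0 : L ^ (i + 1 - 1 - i) = 1 := by rw [show i + 1 - 1 - i = 0 by omega, pow_zero]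
    rw [hrw, h0, one_mul, geom_mixed_sum L hL i, eq_div_iff hLL, add_mul, mul_assoc, div_mul_cancel₀ _ hLL]
    ring

/-- ★★★ **(C-word), (BKG)-CLASS EDITION**: for a finest-lattice `SU(2)` field `U₀` with `dist1 (U₀ ℓ) ≤ σ₀` and the station's (BKG) plaquette profile
`dist1 ((Ū^t U₀)(∂p)) ≤ C_B·α·L^{2t}·(L⁻¹)^{2(K−J)}` (`t ≤ K − J`; loop smallness `((d+2)L)²∕4·(C_B·α) < δ₂`, `≤ 1∕6`), every bond of every averaged level obeys
`dist1 (Ū^i U₀ b) ≤ L^i·σ₀ + (2·((d+2)L)²∕4)·(C_B·α·(L⁻¹)^{2(K−J)})·(L^{2i} − L^i)∕(L² − L)` (`i ≤ K − J`) — the exact solution of §2's recursion; with `σ₀ = η·s₀`,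
`η = (L⁻¹)^{K−J}`, this is px17's «`≤ (s₀ + C·C_B·α)·L^i·η`» (`L^{2i}η² ≤ L^iη ≤ 1`). [cite: Balaban1987RG1, (0.4), (0.11) p.253; Balaban1985Averaging, (19)-(20) p.21] -/
theorem dist1_iter_le_bkg {J K : ℕ} (U₀ : GaugeField (F.P K) 0 (Matrix.specialUnitaryGroup (Fin 2) ℂ))
    {σ₀ C_B α : ℝ} (hσ₀ : ∀ ℓ, dist1 (U₀ ℓ) ≤ σ₀) (hCB : 0 ≤ C_B) (hα : 0 ≤ α)
    (hBKG : ∀ t, t ≤ K - J → ∀ p : Plaq (F.P K) t,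
      dist1 (GaugeField.plaqHol (Averaging.iter (fun k => BlockAveraging.blockAvg (P := F.P K) (j := k) ℰp) t U₀) p) ≤
        C_B * α * (F.L : ℝ) ^ (2 * t) * ((F.L : ℝ)⁻¹) ^ (2 * (K - J)))
    (hδ : ((((3 + 2) * F.L : ℕ) : ℝ) ^ 2 / 4) * (C_B * α) < deltaSU (Fin 2))
    (h6 : ((((3 + 2) * F.L : ℕ) : ℝ) ^ 2 / 4) * (C_B * α) ≤ 1 / 6) :
    ∀ i, i ≤ K - J → ∀ b : PBond (F.P K) i,
      dist1 (Averaging.iter (fun k => BlockAveraging.blockAvg (P := F.P K) (j := k) ℰp) i U₀ b) ≤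
        (F.L : ℝ) ^ i * σ₀ + (2 * (((((3 + 2) * F.L : ℕ) : ℝ) ^ 2 / 4))) * (C_B * α * ((F.L : ℝ)⁻¹) ^ (2 * (K - J))) *
          (((F.L : ℝ) ^ (2 * i) - (F.L : ℝ) ^ i) / ((F.L : ℝ) ^ 2 - F.L)) := by
  intro i hi b
  have hL1 : (1 : ℝ) < (F.L : ℝ) := by exact_mod_cast F.hL.2
  have hL0 : (0 : ℝ) ≤ (F.L : ℝ) := by linarith
  have hη1 : ((F.L : ℝ)⁻¹) ^ (2 * (K - J)) ≤ 1 := pow_le_one₀ (inv_nonneg.mpr hL0) (inv_le_one_of_one_le₀ hL1.le)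
  -- the per-level plaquette bound `a k := C_B·α·L^{2k}·η²` is at most `C_B·α` for `k ≤ K − J`
  have hak : ∀ k, k ≤ K - J → C_B * α * (F.L : ℝ) ^ (2 * k) * ((F.L : ℝ)⁻¹) ^ (2 * (K - J)) ≤ C_B * α := by
    intro k hk
    have h1 : (F.L : ℝ) ^ (2 * k) * ((F.L : ℝ)⁻¹) ^ (2 * (K - J)) ≤ 1 := by
      rw [inv_pow, ← div_eq_mul_inv, div_le_one (pow_pos (by linarith) _)]
      exact pow_le_pow_right₀ hL1.le (by omega)
    have h2 : 0 ≤ C_B * α := mul_nonneg hCB hα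
    nlinarith
  have hd : (F.P K).d = 3 := rfl
  have hPL : (F.P K).L = F.L := rfl
  have key := dist1_iter_le_of_bond_le (n := Fin 2) (P := F.P K) U₀ hσ₀ (K - J)
    (fun k => C_B * α * (F.L : ℝ) ^ (2 * k) * ((F.L : ℝ)⁻¹) ^ (2 * (K - J)))
    (fun k _ => by positivity) (fun k hk q => hBKG k hk.le q)
    (fun k hk => by rw [hd, hPL]; exact lt_of_le_of_lt (mul_le_mul_of_nonneg_left (hak k hk.le) (by positivity)) hδ)
    (fun k hk => by rw [hd, hPL]; exact (mul_le_mul_of_nonneg_left (hak k hk.le) (by positivity)).trans h6) i hi b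
  rw [hd, hPL] at key
  refine key.trans (le_of_eq ?_)
  rw [← geom_mixed_sum (F.L : ℝ) hL1 i, Finset.mul_sum]
  congr 1
  refine Finset.sum_congr rfl fun k _ => ?_
  ring

/-- ★★ **THE ONE-LINE COROLLARY IN `η`-UNITS**: `dist1 (Ū^i U₀ b) ≤ L^i·σ₀ + ((3+2)²·L∕(2(L−1)))·(C_B·α)·(L^i·(L⁻¹)^{K−J})²`. [cite: Balaban1987RG1, (0.4), (0.11) p.253] -/
theorem dist1_iter_le_bkg' {J K : ℕ} (U₀ : GaugeField (F.P K) 0 (Matrix.specialUnitaryGroup (Fin 2) ℂ))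
    {σ₀ C_B α : ℝ} (hσ₀ : ∀ ℓ, dist1 (U₀ ℓ) ≤ σ₀) (hCB : 0 ≤ C_B) (hα : 0 ≤ α)
    (hBKG : ∀ t, t ≤ K - J → ∀ p : Plaq (F.P K) t,
      dist1 (GaugeField.plaqHol (Averaging.iter (fun k => BlockAveraging.blockAvg (P := F.P K) (j := k) ℰp) t U₀) p) ≤
        C_B * α * (F.L : ℝ) ^ (2 * t) * ((F.L : ℝ)⁻¹) ^ (2 * (K - J)))
    (hδ : ((((3 + 2) * F.L : ℕ) : ℝ) ^ 2 / 4) * (C_B * α) < deltaSU (Fin 2))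
    (h6 : ((((3 + 2) * F.L : ℕ) : ℝ) ^ 2 / 4) * (C_B * α) ≤ 1 / 6)
    (i : ℕ) (hi : i ≤ K - J) (b : PBond (F.P K) i) :
    dist1 (Averaging.iter (fun k => BlockAveraging.blockAvg (P := F.P K) (j := k) ℰp) i U₀ b) ≤
      (F.L : ℝ) ^ i * σ₀ + ((3 + 2) ^ 2 * (F.L : ℝ) / (2 * ((F.L : ℝ) - 1))) * (C_B * α) * ((F.L : ℝ) ^ i * ((F.L : ℝ)⁻¹) ^ (K - J)) ^ 2 := by
  have h := dist1_iter_le_bkg F U₀ hσ₀ hCB hα hBKG hδ h6 i hi b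
  have hL1 : (1 : ℝ) < (F.L : ℝ) := by exact_mod_cast F.hL.2
  refine h.trans ?_
  have hLL : 0 < (F.L : ℝ) ^ 2 - F.L := by nlinarith
  have hL1' : 0 < (F.L : ℝ) - 1 := by linarith
  have hCα : 0 ≤ C_B * α := mul_nonneg hCB hα
  have hηpos : 0 ≤ ((F.L : ℝ)⁻¹) ^ (2 * (K - J)) := pow_nonneg (inv_nonneg.mpr (by linarith)) _
  have hLi : 0 ≤ (F.L : ℝ) ^ i := pow_nonneg (by linarith) _
  -- drop the `−L^i` and compare the two closed forms
  have h1 : ((F.L : ℝ) ^ (2 * i) - (F.L : ℝ) ^ i) / ((F.L : ℝ) ^ 2 - F.L) ≤ (F.L : ℝ) ^ (2 * i) / ((F.L : ℝ) ^ 2 - F.L) :=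
    div_le_div_of_nonneg_right (by linarith) hLL.le
  have h2 : (2 * (((((3 + 2) * F.L : ℕ) : ℝ) ^ 2 / 4))) * (C_B * α * ((F.L : ℝ)⁻¹) ^ (2 * (K - J))) * ((F.L : ℝ) ^ (2 * i) / ((F.L : ℝ) ^ 2 - F.L)) =
      ((3 + 2) ^ 2 * (F.L : ℝ) / (2 * ((F.L : ℝ) - 1))) * (C_B * α) * ((F.L : ℝ) ^ i * ((F.L : ℝ)⁻¹) ^ (K - J)) ^ 2 := by
    have hL0 : (F.L : ℝ) ≠ 0 := by linarith
    have hL1ne : (F.L : ℝ) - 1 ≠ 0 := by linarith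
    rw [show (F.L : ℝ) ^ 2 - F.L = F.L * ((F.L : ℝ) - 1) by ring]
    simp only [pow_mul', inv_pow]
    push_cast
    field_simp
    ring
  nlinarith [mul_le_mul_of_nonneg_left h1 (mul_nonneg (by positivity : (0 : ℝ) ≤ 2 * (((((3 + 2) * F.L : ℕ) : ℝ) ^ 2 / 4))) (mul_nonneg hCα hηpos))]

/-- ★★ **THE DESCENDED EDITION** (the `s′` of w5 g29's ✓`bondGrad_descTransf_le_of_descent`∕(RES-u.7σ) §6): every bond of the descended field
`descendTo F ℰp J K hJK U₀ = Ū^{K−J} U₀` (read on the `J`-th tower) is within `L^{K−J}·σ₀ + ((3+2)²L∕(2(L−1)))·(C_B·α)` of `1` — with `σ₀ = η·s₀`,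
`η = (L⁻¹)^{K−J}`, this is `s′ := s₀ + C·C_B·α`. [cite: Balaban1987RG1, (0.4), (0.11) p.253] -/
theorem dist1_descendTo_le_bkg {J K : ℕ} (hJK : J ≤ K) (U₀ : GaugeField (F.P K) 0 (Matrix.specialUnitaryGroup (Fin 2) ℂ))
    {σ₀ C_B α : ℝ} (hσ₀ : ∀ ℓ, dist1 (U₀ ℓ) ≤ σ₀) (hCB : 0 ≤ C_B) (hα : 0 ≤ α)
    (hBKG : ∀ t, t ≤ K - J → ∀ p : Plaq (F.P K) t,
      dist1 (GaugeField.plaqHol (Averaging.iter (fun k => BlockAveraging.blockAvg (P := F.P K) (j := k) ℰp) t U₀) p) ≤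
        C_B * α * (F.L : ℝ) ^ (2 * t) * ((F.L : ℝ)⁻¹) ^ (2 * (K - J)))
    (hδ : ((((3 + 2) * F.L : ℕ) : ℝ) ^ 2 / 4) * (C_B * α) < deltaSU (Fin 2))
    (h6 : ((((3 + 2) * F.L : ℕ) : ℝ) ^ 2 / 4) * (C_B * α) ≤ 1 / 6)
    (B : PBond (F.P J) 0) :
    dist1 (descendTo F ℰp J K hJK U₀ B) ≤
      (F.L : ℝ) ^ (K - J) * σ₀ + ((3 + 2) ^ 2 * (F.L : ℝ) / (2 * ((F.L : ℝ) - 1))) * (C_B * α) := by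
  have hL1 : (1 : ℝ) < (F.L : ℝ) := by exact_mod_cast F.hL.2
  have h := dist1_iter_le_bkg' F U₀ hσ₀ hCB hα hBKG hδ h6 (K - J) le_rfl
    (bondShift (F.sitesPerDir_eq (m := F.m) (K := J) (j := 0) (m' := F.m) (K' := K) (j' := K - J) (by omega)) B)
  have hone : ((F.L : ℝ) ^ (K - J) * ((F.L : ℝ)⁻¹) ^ (K - J)) ^ 2 = 1 := by
    rw [← mul_pow, mul_inv_cancel₀ (by positivity), one_pow, one_pow]
  rw [hone, mul_one] at h
  exact h

end Bkg

end Summit.QuantumFields.YangMills.Theorems.FluctuationComparisonRegPrIntLS2BetaAveragedBondWord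

end
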